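import Mathlib
import Literature.NumberTheory.EllipticCurves.Rank1Residual.Typed.Basic
import Literature.NumberTheory.EllipticCurves.QuadraticTwist
import Summits.BirchSwinnertonDyer.BirchSwinnertonDyer.Theses.PrintCf2
import Summits.BirchSwinnertonDyer.BirchSwinnertonDyer.Theses.SylvesterTwoHeegnerIndex

/-!
# Sketch — crux idea `redei-layer-matching` (seat bsd-idea-20 g3, critic idea-crit-15)

Host crux: `UpperOffV0HSYPlus` (stmt-BirchSwinnertonDyer-19804, route SylvesterTwoHeegnerIndex; line of
record = ROAD (k), VARIANT K).  Director-bsd g12 KEY (c)(M4)(b): the classes 𝒞_i (j = 1728) and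
𝒞_{√−2} (j = 8000) — 2 RAMIFIED in the CM field, a RATIONAL 2-torsion point — are out of ROAD (k)'s reach
and need a different mechanism.  This file types the FIRST CHECKABLE STATEMENTS of the proposed mechanism
("Rédei layer matching": one reciprocity object — Rédei / triple-Massey symbols of the prime factors of
the twist — computes BOTH the Cassels–Tate layer of Ш[2^∞] and the second 2-divisibility layer of the
Heegner point), namely its FIRST OFF-𝒱₀ RUNG in three habitats:

* `LayerTwoHabitat W` : `#Ш(W)[2^∞] = 4` — the first layer past the corner 𝒱₀ = {Ш[2] = 0}; for an
  elliptic curve over `ℚ` with finite Ш this is `Ш[2^∞] ≅ (ℤ/2)²` (Cassels: alternating, square order).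
* `RamifiedLayerTwoRung`   — the companion class as the tree types it (`HasCM ∧ CMRamified · 2`:
  j ∈ {1728, 287496, 8000}), conclusion `BSDp W 2`; feeds BY NAME `PrintCf2.RamifiedOffTYZOfFacts`
  (stmt-BirchSwinnertonDyer-20509), which contains every off-TYZ member of that class.
* `SqrtMinusTwoLayerTwoRung` — the same on the explicit 𝒞_{√−2} family `sqrtMinusTwoTwist d`
  (y² = x³ + 4dx² + 2d²x, Δ = 2⁹d⁶ certified below), the recorded uncovered gap (no printed door).
* `CubeSumLayerTwoRung`     — the analogue on the host crux's own family (cube-sum prime twists,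
  conclusion in the host's currency `MissingUpperBoundAt · 2`): there the role of Rédei symbols is played
  by the 2-class field tower of `ℚ(∛p)` (Chao Li 2019 / Kezuka–Li 2020 give layer 1).

Nothing here is a theorem about BSD; the rungs are `Prop`s.  `sorry`-free.  No summit statement is
proved by this seat.
-/

set_option linter.dupNamespace false

namespace Summit.BirchSwinnertonDyer.BirchSwinnertonDyer.Cruxes.UpperOffV0HSYPlus.RedeiLayerMatching

open Literature.NumberTheory.EllipticCurves
open Literature.NumberTheory.EllipticCurves.Rank1Residual
open Literature.NumberTheory.EllipticCurves.Rank1Residual.Typed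

/-- The LAYER-2 HABITAT: the 2-primary part of Ш has order exactly 4 (for an elliptic curve over `ℚ`
with finite Ш: `Ш[2^∞] ≅ (ℤ/2ℤ)²`, i.e. `dim Ш[2] = 2` and the Cassels–Tate pairing on `Ш[2]` is
non-degenerate).  The corner 𝒱₀ of the cell is `#Ш[2^∞] = 1`; this is the first layer past it. -/
def LayerTwoHabitat (W : WeierstrassCurve ℚ) [W.IsElliptic] : Prop :=
  Nat.card (AddCommGroup.primaryComponent W.sha 2) = 4

/-- On the layer-2 habitat the 2-primary part of Ш is finite (bookkeeping used by every rung). -/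
theorem finite_of_layerTwoHabitat (W : WeierstrassCurve ℚ) [W.IsElliptic] (h : LayerTwoHabitat W) :
    Finite (AddCommGroup.primaryComponent W.sha 2) := by
  apply Nat.finite_of_card_ne_zero
  rw [h]; decide

/-- RUNG (companion class, tree currency): every globally minimal CM elliptic curve over `ℚ` of
analytic rank one with 2 RAMIFIED in the CM field (j ∈ {1728, 287496, 8000}) whose Ш has 2-primary
part of order 4 satisfies `BSD(E, 2)`.  Strictly inside `PrintCf2.RamifiedOffTYZOfFacts` (stmt-20509:
every such curve is off the proved TYZ families, which have Ш[2] = 0); the first off-𝒱₀ layer of it. -/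
def RamifiedLayerTwoRung : Prop :=
  ∀ (W : WeierstrassCurve ℚ) [W.IsElliptic] [W.IsGloballyMinimal],
    W.HasCM → CMRamified W 2 → W.analyticRank = 1 → LayerTwoHabitat W → BSDp W 2

/-- The explicit 𝒞_{√−2} family: `E_d : y² = x³ + 4d·x² + 2d²·x` (j = 8000, CM by `ℤ[√−2]`,
`E_d[√−2] = ⟨(0,0)⟩` rational; the quadratic twist by `d` of `y² = x³ + 4x² + 2x`, conductor 256). -/
def sqrtMinusTwoTwist (d : ℤ) : WeierstrassCurve ℚ :=
  ⟨0, 4 * (d : ℚ), 0, 2 * (d : ℚ) ^ 2, 0⟩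

/-- Certified invariants of the family: `Δ(E_d) = 2⁹ d⁶` (so for odd square-free `d` the model is
minimal at every prime: `ord_p Δ = 6 < 12`, `ord₂ Δ = 9 < 12`) … -/
theorem sqrtMinusTwoTwist_Δ (d : ℤ) : (sqrtMinusTwoTwist d).Δ = 512 * (d : ℚ) ^ 6 := by
  simp only [sqrtMinusTwoTwist, WeierstrassCurve.Δ, WeierstrassCurve.b₂, WeierstrassCurve.b₄,
    WeierstrassCurve.b₆, WeierstrassCurve.b₈]
  ring

/-- … and `c₄(E_d) = 160 d²`, whence `j = c₄³/Δ = 8000`. -/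
theorem sqrtMinusTwoTwist_c₄ (d : ℤ) : (sqrtMinusTwoTwist d).c₄ = 160 * (d : ℚ) ^ 2 := by
  simp only [sqrtMinusTwoTwist, WeierstrassCurve.c₄, WeierstrassCurve.b₂, WeierstrassCurve.b₄]
  ring

/-- `j(E_d) = 8000` as the identity `c₄³ = 8000 · Δ` (avoids division; `Δ ≠ 0` for `d ≠ 0`). -/
theorem sqrtMinusTwoTwist_c₄_cube (d : ℤ) :
    (sqrtMinusTwoTwist d).c₄ ^ 3 = 8000 * (sqrtMinusTwoTwist d).Δ := by
  rw [sqrtMinusTwoTwist_c₄, sqrtMinusTwoTwist_Δ]; ring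

/-- RUNG (𝒞_{√−2}, the recorded gap): for odd square-free `d`, every globally minimal model of `E_d`
of analytic rank one on the layer-2 habitat satisfies `BSD(E_d, 2)`. -/
def SqrtMinusTwoLayerTwoRung : Prop :=
  ∀ d : ℤ, Squarefree d → Odd d →
    ∀ (W : WeierstrassCurve ℚ) [W.IsElliptic] [W.IsGloballyMinimal],
      (∃ C : WeierstrassCurve.VariableChange ℚ, C • W = sqrtMinusTwoTwist d) →
      W.analyticRank = 1 → LayerTwoHabitat W → BSDp W 2

/-- FIRST RUNG (critic V#14 P3: the class `𝒞_i` alone — full rational 2-torsion, where the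
Cassels–Tate form on `Ш[2]` is the Smith / Swinnerton-Dyer base case `k = 2` in Rédei symbols):
for square-free `n ≡ 5, 6, 7 (mod 8)`, every globally minimal model of the congruent number curve
`E_n : y² = x³ − n²x` (`congruentNumberCurve n`) of analytic rank `1` with `#Ш[2^∞] = 4` satisfies
`BSD₂`.  The habitat is level-1-MUTE (census `RedeiLayerMatchingCensus.lean`: for `n ≤ 10⁵` no odd member
with Monsky `s(n) ≥ 3` has an odd TYZ genus sum), so this rung is disjoint from every printed TYZ family. -/
def CongruentLayerTwoRung : Prop :=
  ∀ n : ℕ, Squarefree n → (n % 8 = 5 ∨ n % 8 = 6 ∨ n % 8 = 7) →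
    ∀ (W : WeierstrassCurve ℚ) [W.IsElliptic] [W.IsGloballyMinimal],
      (∃ C : WeierstrassCurve.VariableChange ℚ, C • W = congruentNumberCurve n) →
      W.analyticRank = 1 → LayerTwoHabitat W → BSDp W 2

/-- RUNG (host family, host currency): for a prime `p ≡ 4, 7 (mod 9)`, every globally minimal model of
the cube-sum curve `C_p` of analytic rank one on the layer-2 habitat has the MISSING UPPER BOUND at 2.
This is the first off-𝒱₀ layer of the host crux's habitat (refuter census of stmt-19804: off-𝒱₀ members
exist, e.g. 465 with `p ≤ 2·10⁵`). -/
def CubeSumLayerTwoRung : Prop :=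
  ∀ p : ℕ, p.Prime → (p % 9 = 4 ∨ p % 9 = 7) →
    ∀ (B : WeierstrassCurve ℚ) [B.IsElliptic] [B.IsGloballyMinimal],
      (∃ C : WeierstrassCurve.VariableChange ℚ, C • B = HuShuYin2019.cubeSumCurve (p : ℚ)) →
      B.analyticRank = 1 → LayerTwoHabitat B → MissingUpperBoundAt B 2

/-- Bookkeeping: `BSD(E,2)` (with Ш finite, as GZK gives in analytic rank one) implies the host
currency `MissingUpperBoundAt E 2` — the tree's `missingPPartAt_of_bsdp` + `lower_and_upper_of_missingPPartAt`. -/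
theorem missingUpperBoundAt_of_bsdp (W : WeierstrassCurve ℚ) [W.IsElliptic] [Finite W.sha]
    (h : BSDp W 2) : MissingUpperBoundAt W 2 := by
  have hPP : MissingPPartAt W 2 := missingPPartAt_of_bsdp W 2 h
  exact (lower_and_upper_of_missingPPartAt W 2 hPP).2

/-- The typed conclusion this companion feeds, BY NAME (item stmt-BirchSwinnertonDyer-20509). -/
abbrev CompanionTarget : Prop :=
  Summit.BirchSwinnertonDyer.BirchSwinnertonDyer.Theses.PrintCf2.RamifiedOffTYZOfFacts

/-- The host crux, BY NAME, for the record: this idea does NOT conclude it (ROAD (k) does, via VARIANT K);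
`CubeSumLayerTwoRung` is the first off-𝒱₀ layer of its habitat in its own currency. -/
abbrev HostCrux : Prop :=
  Summit.BirchSwinnertonDyer.BirchSwinnertonDyer.Theses.SylvesterTwoHeegnerIndex.UpperOffV0HSYPlus

end Summit.BirchSwinnertonDyer.BirchSwinnertonDyer.Cruxes.UpperOffV0HSYPlus.RedeiLayerMatching
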